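import Mathlib
import Summits.CriticalPhenomena.PercolationContinuityZ3.Theorems.PercNearOneGluingNoHeavyLowerTailThreeFamilyTripleHall

/-!
# The three-family Marica–Schönheim inequality (down-closed form), final statement

Helper file for crux `stmt-CriticalPhenomena-4575` (`NoHeavyLowerTail`, route `PercNearOneGluingNoHeavy`),
new-inequality factory seat `prim-ineq-gen-3` (gen 9).  Everything here is PROVED.

**Theorem (MS3-down).**  Let `P, Q, R` be finite families of subsets of a finite set `S` which are pairwise
*cross-intersecting* (`X ∩ Y ≠ ∅` whenever `X`, `Y` lie in different families) and have no member common to all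
three.  Then
`#P + #Q + #R ≤ #G(S; P, Q, R)`,
where `G(S;P,Q,R)` (`ThreeFamilyRank.downFamily`) is the family of subsets of `S` lying inside some within-family
difference `X \ X'`, some cross meet `X ∩ Y`, or some double difference `X \ (Y ∪ Z)` (one member from each family).
This is `ThreeFamilyRank.card_le_card_downFamily` with the intersection hypothesis weakened to cross pairs only —
the faithful abstract form (Theorem A′ `card_add_card_add_card_le` + `TRIPLE` `V_inf_V_inf_V_eq_bot`).  For one
family it is (the down-closed weakening of) Marica–Schönheim `|A − A| ≥ |A|`; the double differences are necessary
(`P={sa,sb,sab}, Q={sc,sd,scd}, R={se,sf,sef}` has `9` members but only `8` sets inside differences and cross meets).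
(prim-ineq-gen-3 gen 9, 2026-08-20; memo `run/shared/lean/prim/prim-ineq-gen-3/PROOF-TRIPLE0.md`.)
-/

namespace Summit.CriticalPhenomena.PercolationContinuityZ3.Theorems

namespace ThreeFamilyRank

open Finset Module
open scoped FinsetFamily

variable {α : Type*} [DecidableEq α]

/-- **Three-family Marica–Schönheim (down-closed form).**  Pairwise cross-intersecting families of subsets of `S`
with no common member satisfy `#P + #Q + #R ≤ #G(S; P, Q, R)`. -/
theorem card_le_card_downFamily_of_cross (S : Finset α) (P Q R : Finset (Finset α))
    (hPS : ∀ X ∈ P, X ⊆ S) (hQS : ∀ Y ∈ Q, Y ⊆ S) (hRS : ∀ Z ∈ R, Z ⊆ S)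
    (hPQ : ∀ X ∈ P, ∀ Y ∈ Q, (X ∩ Y).Nonempty) (hQR : ∀ Y ∈ Q, ∀ Z ∈ R, (Y ∩ Z).Nonempty)
    (hRP : ∀ Z ∈ R, ∀ X ∈ P, (Z ∩ X).Nonempty)
    (hcommon : ∀ U ∈ P, U ∈ Q → U ∉ R) :
    #P + #Q + #R ≤ #(downFamily S P Q R) := by
  refine card_add_card_add_card_le_of_triple (downFamily S P Q R) (downFamily_down S P Q R) P Q R
    ?_ ?_ ?_ ?_ ?_ ?_ (V_inf_V_inf_V_eq_bot S P Q R hPS hQS hRS hcommon)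
  · intro X hX X' hX'
    exact mem_downFamily.mpr ⟨Finset.sdiff_subset.trans (hPS X hX), _,
      sdiff_mem_gens_of_mem (Or.inl ⟨hX, hX'⟩), subset_rfl⟩
  · intro Y hY Y' hY'
    exact mem_downFamily.mpr ⟨Finset.sdiff_subset.trans (hQS Y hY), _,
      sdiff_mem_gens_of_mem (Or.inr (Or.inl ⟨hY, hY'⟩)), subset_rfl⟩
  · intro Z hZ Z' hZ'
    exact mem_downFamily.mpr ⟨Finset.sdiff_subset.trans (hRS Z hZ), _,
      sdiff_mem_gens_of_mem (Or.inr (Or.inr ⟨hZ, hZ'⟩)), subset_rfl⟩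
  · intro X hX Y hY
    exact ⟨mem_downFamily.mpr ⟨Finset.inter_subset_left.trans (hPS X hX), _,
      inter_mem_gens_of_mem (Or.inl ⟨hX, hY⟩), subset_rfl⟩, hPQ X hX Y hY⟩
  · intro Y hY Z hZ
    exact ⟨mem_downFamily.mpr ⟨Finset.inter_subset_left.trans (hQS Y hY), _,
      inter_mem_gens_of_mem (Or.inr (Or.inl ⟨hY, hZ⟩)), subset_rfl⟩, hQR Y hY Z hZ⟩
  · intro Z hZ X hX
    exact ⟨mem_downFamily.mpr ⟨Finset.inter_subset_left.trans (hRS Z hZ), _,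
      inter_mem_gens_of_mem (Or.inr (Or.inr ⟨hZ, hX⟩)), subset_rfl⟩, hRP Z hZ X hX⟩

/-- The same with the natural ground set `S = ⋃ (P ∪ Q ∪ R)`: no containment hypothesis. -/
theorem card_le_card_downFamily_sup (P Q R : Finset (Finset α))
    (hPQ : ∀ X ∈ P, ∀ Y ∈ Q, (X ∩ Y).Nonempty) (hQR : ∀ Y ∈ Q, ∀ Z ∈ R, (Y ∩ Z).Nonempty)
    (hRP : ∀ Z ∈ R, ∀ X ∈ P, (Z ∩ X).Nonempty)
    (hcommon : ∀ U ∈ P, U ∈ Q → U ∉ R) :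
    #P + #Q + #R ≤ #(downFamily ((P ∪ Q ∪ R).sup id) P Q R) := by
  have hS : ∀ U ∈ P ∪ Q ∪ R, U ⊆ (P ∪ Q ∪ R).sup id := fun U hU => Finset.le_sup (f := id) hU
  exact card_le_card_downFamily_of_cross _ P Q R (fun X hX => hS X (by simp [hX]))
    (fun Y hY => hS Y (by simp [hY])) (fun Z hZ => hS Z (by simp [hZ])) hPQ hQR hRP hcommon

end ThreeFamilyRank

end Summit.CriticalPhenomena.PercolationContinuityZ3.Theorems
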